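import Summits.CriticalPhenomena.CardyFormulaZ2.Theses.CardyQContinuation
import Literature.Probability.Percolation.QuadCrossingSquareModel
import Literature.Probability.RandomPlanarGeometry.JordanIndexOne
import Literature.Probability.RandomPlanarGeometry.PolygonalDomains
import Summits.CriticalPhenomena.CardyFormulaZ2.Theorems.CardyQContinuationIsingJetsConformalStubDesignUpperContinuumPart1
import Summits.CriticalPhenomena.CardyFormulaZ2.Theorems.CardyQContinuationIsingJetsConformalStubDesignUpperContinuumPart2

/-!
# Crux `IsingJetsConformal`, registered stub `stub_design_upper_continuum`:
# the upper comparison domain `R⁺` of the `n = 0` sandwich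
# (route `CardyQContinuation`, item stmt-CriticalPhenomena-5560, `n = 0` bridge)

Given an ORIENTED SQUARE MODEL `Ψ` of every conformal rectangle (the neighbour stub
`stub_design_squareModel`, taken here as the hypothesis `hS`: `Ψ` maps the model square, its
bottom and top sides onto `R`, `R.arc 0`, `R.arc 2`; conformal rectangles whose boundary loop is
uniformly `ε`-close to `Ψ ∘ ∂(square)` have index `1`; and along every sequence of conformal
rectangles with the quarter marks whose boundary loops converge uniformly to `Ψ ∘ ∂(square)` the
cross-ratios of ALL uniformizing data converge to the conformal modulus of `R` — Radó), we
construct, for every conformal rectangle `R` and `τ > 0`, the UPPER comparison domain `R⁺` of the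
`n = 0` sandwich: a rectilinear polygonal conformal rectangle (`R⁺.boundary = polygonLoop l ∘ ρ`
for a simple closed polygon `l` whose consecutive vertices share a coordinate and an increasing
homeomorphism `ρ` of `ℝ` commuting with the unit translation, `R⁺.carrier` = the inside of the
polygon) of index `1`, with conformal modulus `τ`-close to that of `R` (U1), whose free arcs `1`,
`3` lie strictly outside `closure R` (U3), whose closure misses `R.arc 0 ∪ R.arc 2` (U4), and such
that `closure R ∖ R⁺` and the arcs `0`, `2` of `R⁺` lie within `s` of the corresponding arcs of
`R`, for an `s` so small that no point is `2s`-close to both (U6).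

Construction. For `t ∈ (0, 1/4]` let `D_t = Ψ((-1-t, 1+t) × (-1+t, 1-t))` (`perturbQuad`), the
image of the wider-and-shorter rectangle. Along `t_m = 1/(m+5) → 0⁺` let `Q m` be the rectilinear
shadow of `D_{t_m}` (`DesignUpperContinuum.exists_rectilinear_close'`, part 1) at precision
`min (1/(m+1)) (ε₁ m)`, where `ε₁ m` is the model-reading tolerance of
`DesignUpperContinuum.upper_model_reading` (part 2). Then `∂(Q m) → Ψ ∘ ∂(square)` uniformly
(`DesignUpperContinuum.exists_forall_dist_perturbQuad_boundary_lt`), so for `m` large: the index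
is `1` (orientation clause); (U1) holds (Radó clause applied to a sequence of worst data, the
modulus being datum-independent by `ConformalRectangle.crossRatio_eq_of_isUniformizing_holds`);
(U3), (U4) hold for every `m` and (U6) as soon as `3 t_m` is below the modulus of uniform
continuity of `Ψ` on `[-2, 2]²` at the separation scale `s` of
`DesignUpperContinuum.exists_arcs_separated` (part 2). `R⁺ := Q m` for one such `m`.
No new definitions; no new mathematics beyond the cited tree facts. [folklore]
-/

namespace Summit.CriticalPhenomena.CardyFormulaZ2.Theorems.CardyQContinuation

open Set Metric Filter Topology Complex
open Literature.Probability.RandomPlanarGeometry Literature.Probability.Percolation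

open DesignUpperContinuum in
/-- **Registered stub `stub_design_upper_continuum`** of the `n = 0` bridge of the crux
`IsingJetsConformal` (stmt-CriticalPhenomena-5560): from an oriented square model with Radó
convergence (the statement of the neighbour stub `stub_design_squareModel`), every conformal
rectangle `R` admits for every `τ > 0` an upper comparison domain `R⁺` — a rectilinear polygonal
conformal rectangle of index `1` with modulus `τ`-close to that of `R`, free arcs outside
`closure R`, closure off `R.arc 0 ∪ R.arc 2`, and black arcs / defect `closure R ∖ R⁺` within a
separated distance `s` of the black arcs of `R`. See the module docstring. [folklore] -/
theorem stub_design_upper_continuum : ((∀ R : Literature.Probability.RandomPlanarGeometry.ConformalRectangle, ∃ Ψ : ℂ ≃ₜ ℂ, Ψ '' Literature.Probability.Percolation.unitSquareQuad.carrier = R.carrier ∧ Ψ '' Literature.Probability.Percolation.unitSquareQuad.arc 0 = R.arc 0 ∧ Ψ '' Literature.Probability.Percolation.unitSquareQuad.arc 2 = R.arc 2 ∧ Ψ '' (Literature.Probability.Percolation.unitSquareQuad.arc 1 ∪ Literature.Probability.Percolation.unitSquareQuad.arc 3) = R.arc 1 ∪ R.arc 3 ∧ (∃ ε : ℝ, 0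 < ε ∧ ∀ P : Literature.Probability.RandomPlanarGeometry.ConformalRectangle, (∀ s : ℝ, dist (P.boundary s) ((Literature.Probability.Percolation.unitSquareQuad.map Ψ).boundary s) ≤ ε) → ∀ z ∈ P.carrier, P.toJordanDomain.index z = 1) ∧ (∀ Q : ℕ → Literature.Probability.RandomPlanarGeometry.ConformalRectangle, TendstoUniformly (fun m ↦ (Q m).boundary) (Literature.Probability.Percolation.unitSquareQuad.map Ψ).boundary Filter.atTop → (∀ m i, (Q m).mark i = Literature.Probability.Percolation.quarterMarks i) → ∀ (ψ : ∀ m, Literature.Probability.RandomPlanarGeometry.ConformalEquiv UpperHalfPlane.upperHalfPlaneSet (Q m).carrier) (y : ℕ → Fin 4 → ℝ), (∀ m, (Q m).IsUniformizing (ψ m) (y m)) → ∀ (φ : Literature.Probability.RandomPlanarGeometry.ConformalEquiv UpperHalfPlane.upperHalfPlaneSet R.carrier) (x : Fin 4 → ℝ), R.IsUniformizing φ x → Filter.Tendsto (fun m ↦ Literature.Probability.RandomPlanarGeometry.crossRatio (y m)) Filter.atTop (nhds (Literature.Probability.RandomPlanarGeometry.crossRatio x)))) → (∀ (R : Literature.Probability.RandomPlanarGeometry.ConformalRectangle)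 (τ : ℝ), 0 < τ → ∃ (Rp : Literature.Probability.RandomPlanarGeometry.ConformalRectangle) (l : List ℂ) (h : Literature.Probability.RandomPlanarGeometry.IsSimpleClosedPolygon l) (ρ : ℝ → ℝ), (∀ (k : ℕ) (hk : k < l.length), (l[k]).re = (l[(k + 1) % l.length]'(Nat.mod_lt _ h.pos)).re ∨ (l[k]).im = (l[(k + 1) % l.length]'(Nat.mod_lt _ h.pos)).im) ∧ Continuous ρ ∧ StrictMono ρ ∧ Function.Surjective ρ ∧ (∀ s : ℝ, ρ (s + 1) = ρ s + 1) ∧ Rp.boundary = Literature.Probability.RandomPlanarGeometry.polygonLoop l ∘ ρ ∧ Rp.carrier = (Literature.Probability.RandomPlanarGeometry.polygonDomain l h).carrier ∧ (∀ z ∈ Rp.carrier, Rp.toJordanDomain.index z = 1) ∧ (∀ (φ : Literature.Probability.RandomPlanarGeometry.ConformalEquiv UpperHalfPlane.upperHalfPlaneSet R.carrier) (x : Fin 4 → ℝ), R.IsUniformizing φ x → ∀ (φ' : Literature.Probability.RandomPlanarGeometry.ConformalEquiv UpperHalfPlane.upperHalfPlaneSet Rp.carrier) (x' : Fin 4 →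 ℝ), Rp.IsUniformizing φ' x' → |Literature.Probability.RandomPlanarGeometry.crossRatio x' - Literature.Probability.RandomPlanarGeometry.crossRatio x| < τ) ∧ Rp.arc 1 ∪ Rp.arc 3 ⊆ (closure R.carrier)ᶜ ∧ closure Rp.carrier ∩ (R.arc 0 ∪ R.arc 2) = ∅ ∧ (∃ s : ℝ, 0 < s ∧ closure R.carrier \ Rp.carrier ⊆ {z | Metric.infDist z (R.arc 0) < s} ∪ {z | Metric.infDist z (R.arc 2) < s} ∧ Rp.arc 0 ⊆ {z | Metric.infDist z (R.arc 0) < s} ∧ Rp.arc 2 ⊆ {z | Metric.infDist z (R.arc 2) < s} ∧ ∀ z : ℂ, Metric.infDist z (R.arc 0) ≤ 2 * s → Metric.infDist z (R.arc 2) ≤ 2 * s → False))) := by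
  intro hS R τ hτ
  obtain ⟨Ψ, hcar, h0, h2, -, ⟨ε, hε, hidx⟩, hconv⟩ := hS R
  -- the separation scale `s` of the arcs `0`, `2` of `R`, and the modulus `η` of `Ψ` at scale `s`
  obtain ⟨s, hs, hsep⟩ := exists_arcs_separated R
  set K₂ : Set ℂ := Icc (-2) 2 ×ℂ Icc (-2) 2 with hK₂
  have hK₂c : IsCompact K₂ := isCompact_Icc.reProdIm isCompact_Icc
  have huc := hK₂c.uniformContinuousOn_of_continuous Ψ.continuous.continuousOn
  rw [Metric.uniformContinuousOn_iff] at huc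
  obtain ⟨η, hη, hΨη⟩ := huc s hs
  have hsq : unitSquareQuad.arc 0 ∪ unitSquareQuad.arc 2 ⊆ Icc (-1) 1 ×ℂ Icc (-1) 1 := by
    intro p hp
    have : p ∈ closure unitSquareQuad.carrier := frontier_subset_closure (by
      rcases hp with hp | hp <;> exact unitSquareQuad.arc_subset_frontier _ hp)
    rwa [unitSquareQuad_carrier, Complex.closure_reProdIm, closure_Ioo (by norm_num)] at this
  -- the widths `t_m → 0⁺`
  set tt : ℕ → ℝ := fun m => 1 / ((m : ℝ) + 5) with htt
  have htt0 : ∀ m, 0 < tt m := fun m => by show (0 : ℝ) < 1 / ((m : ℝ) + 5); positivity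
  have htt1 : ∀ m, tt m ≤ 1 / ((m : ℝ) + 1) := fun m =>
    one_div_le_one_div_of_le (by positivity) (by linarith)
  have htt4 : ∀ m, tt m ≤ 1 / 4 := fun m =>
    one_div_le_one_div_of_le (by norm_num) (by linarith [(Nat.cast_nonneg m : (0 : ℝ) ≤ m)])
  have hx : ∀ m, (-1 - tt m : ℝ) < 1 + tt m := fun m => by linarith [htt0 m]
  have hy : ∀ m, (-1 + tt m : ℝ) < 1 - tt m := fun m => by linarith [htt4 m]
  have hsmall : ∀ c : ℝ, 0 < c → ∀ᶠ m : ℕ in atTop, 1 / ((m : ℝ) + 1) < c := fun c hc =>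
    (tendsto_one_div_add_atTop_nhds_zero_nat (𝕜 := ℝ)).eventually (gt_mem_nhds hc)
  -- the model-reading tolerances `ε₁ m` and the precisions `εp m → 0`
  have hread0 := fun m => upper_model_reading R Ψ hcar h0 h2 (htt0 m) (htt4 m)
  choose ε₁ hε₁ hread using hread0
  set εp : ℕ → ℝ := fun m => min (1 / ((m : ℝ) + 1)) (ε₁ m) with hεp
  have hεp0 : ∀ m, 0 < εp m := fun m => lt_min (by positivity) (hε₁ m)
  -- the rectilinear shadows `Q m` of `D m = Ψ((-1-t_m, 1+t_m) × (-1+t_m, 1-t_m))`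
  have hsh := fun m => exists_rectilinear_close'
    (perturbQuad Ψ (-1 - tt m) (1 + tt m) (-1 + tt m) (1 - tt m) (hx m) (hy m)) (hεp0 m)
  choose Q l hl ρ hmark hrect hρc hρm hρs hρ1 hbd hcarQ hdist using hsh
  have hmarkQ : ∀ m i, (Q m).mark i = quarterMarks i := fun m i => by rw [hmark]; rfl
  have hclose : ∀ m x, dist ((Q m).boundary x)
      ((perturbQuad Ψ (-1 - tt m) (1 + tt m) (-1 + tt m) (1 - tt m) (hx m) (hy m)).boundary x) ≤
        ε₁ m := fun m x => (hdist m x).trans (min_le_right _ _)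
  have hreadQ := fun m => hread m (Q m) (hmarkQ m) (hclose m)
  -- the boundary loops converge uniformly to `Ψ ∘ ∂(square)`
  have hunif : TendstoUniformly (fun m => (Q m).boundary) (unitSquareQuad.map Ψ).boundary atTop := by
    rw [Metric.tendstoUniformly_iff]
    intro e he
    obtain ⟨t₀, ht₀, hD⟩ := exists_forall_dist_perturbQuad_boundary_lt Ψ (half_pos he)
    filter_upwards [hsmall t₀ ht₀, hsmall (e / 2) (half_pos he)] with m hm1 hm2 x
    have h1 := hD (tt m) (hx m) (hy m) (htt0 m) ((htt1 m).trans hm1.le) x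
    have h2 : dist ((Q m).boundary x)
        ((perturbQuad Ψ (-1 - tt m) (1 + tt m) (-1 + tt m) (1 - tt m) (hx m) (hy m)).boundary x) <
          e / 2 := lt_of_le_of_lt ((hdist m x).trans (min_le_left _ _)) hm2
    rw [dist_comm] at h1 h2
    have := dist_triangle ((unitSquareQuad.map Ψ).boundary x)
      ((perturbQuad Ψ (-1 - tt m) (1 + tt m) (-1 + tt m) (1 - tt m) (hx m) (hy m)).boundary x)
      ((Q m).boundary x)
    linarith
  -- orientation: the index is eventually `1`
  have hidxQ : ∀ᶠ m in atTop, ∀ z ∈ (Q m).carrier, (Q m).toJordanDomain.index z = 1 := by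
    filter_upwards [(Metric.tendstoUniformly_iff.1 hunif) ε hε] with m hm
    exact hidx (Q m) fun x => by rw [dist_comm]; exact (hm x).le
  -- (U1): the conformal moduli are eventually `τ`-close (Radó, by contradiction through a
  -- sequence of worst data)
  have hU1 : ∀ᶠ m in atTop, ∀ (φ : ConformalEquiv UpperHalfPlane.upperHalfPlaneSet R.carrier)
      (x : Fin 4 → ℝ), R.IsUniformizing φ x →
      ∀ (φ' : ConformalEquiv UpperHalfPlane.upperHalfPlaneSet (Q m).carrier) (x' : Fin 4 → ℝ),
        (Q m).IsUniformizing φ' x' → |crossRatio x' - crossRatio x| < τ := by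
    obtain ⟨φ₀, x₀, hφ₀⟩ := MarkedDomain.exists_isUniformizing_holds R
    have hch : ∀ m, ∃ (ψ : ConformalEquiv UpperHalfPlane.upperHalfPlaneSet (Q m).carrier)
        (y : Fin 4 → ℝ), (Q m).IsUniformizing ψ y ∧
          ((∃ (ψ' : ConformalEquiv UpperHalfPlane.upperHalfPlaneSet (Q m).carrier)
            (y' : Fin 4 → ℝ), (Q m).IsUniformizing ψ' y' ∧ τ ≤ |crossRatio y' - crossRatio x₀|) →
            τ ≤ |crossRatio y - crossRatio x₀|) := by
      intro m
      by_cases hbad : ∃ (ψ' : ConformalEquiv UpperHalfPlane.upperHalfPlaneSet (Q m).carrier)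
          (y' : Fin 4 → ℝ), (Q m).IsUniformizing ψ' y' ∧ τ ≤ |crossRatio y' - crossRatio x₀|
      · obtain ⟨ψ', y', h1, h2⟩ := hbad
        exact ⟨ψ', y', h1, fun _ => h2⟩
      · obtain ⟨ψ, y, hψ⟩ := MarkedDomain.exists_isUniformizing_holds (Q m)
        exact ⟨ψ, y, hψ, fun h => absurd h hbad⟩
    choose ψ y hψ hworst using hch
    have hlim := hconv Q hunif hmarkQ ψ y hψ φ₀ x₀ hφ₀
    filter_upwards [Metric.tendsto_nhds.1 hlim τ hτ] with m hm φ x hφx φ' x' hφx'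
    rw [Real.dist_eq] at hm
    rw [ConformalRectangle.crossRatio_eq_of_isUniformizing_holds hφx hφ₀]
    by_contra hge
    push Not at hge
    have := hworst m ⟨φ', x', hφx', hge⟩
    linarith
  -- (U6): eventually `3 t_m < η`, and then everything read in the model transfers to `R`
  have hU6 : ∀ᶠ m in atTop,
      closure R.carrier \ (Q m).carrier ⊆ {z | infDist z (R.arc 0) < s} ∪ {z | infDist z (R.arc 2) < s} ∧
        (Q m).arc 0 ⊆ {z | infDist z (R.arc 0) < s} ∧ (Q m).arc 2 ⊆ {z | infDist z (R.arc 2) < s} := by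
    filter_upwards [hsmall (η / 3) (by positivity)] with m hm
    have h3t : 3 * tt m < η := by linarith [htt1 m]
    obtain ⟨-, -, hR, hA0, hA2⟩ := hreadQ m
    have key : ∀ z w, w ∈ Icc (-1) 1 ×ℂ Icc (-1) 1 → dist (Ψ.symm z) w ≤ 3 * tt m →
        dist z (Ψ w) < s := by
      intro z w hw hd
      obtain ⟨⟨h1, h2⟩, h3, h4⟩ := mem_reProdIm.1 hw
      have hwK : w ∈ K₂ := mem_reProdIm.2 ⟨⟨by linarith, by linarith⟩, by linarith, by linarith⟩
      have hzK : Ψ.symm z ∈ K₂ := by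
        have hre := abs_le.1 (abs_re_sub_le_of_dist_le hd)
        have him := abs_le.1 (abs_im_sub_le_of_dist_le hd)
        have := htt4 m
        exact mem_reProdIm.2 ⟨⟨by linarith, by linarith⟩, by linarith, by linarith⟩
      have := hΨη (Ψ.symm z) hzK w hwK (by linarith)
      rwa [Homeomorph.apply_symm_apply] at this
    have harc0 : ∀ z w, w ∈ unitSquareQuad.arc 0 → dist (Ψ.symm z) w ≤ 3 * tt m →
        infDist z (R.arc 0) < s := fun z w hw hd =>
      (infDist_le_dist_of_mem (by rw [← h0]; exact mem_image_of_mem Ψ hw)).trans_lt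
        (key z w (hsq (Or.inl hw)) hd)
    have harc2 : ∀ z w, w ∈ unitSquareQuad.arc 2 → dist (Ψ.symm z) w ≤ 3 * tt m →
        infDist z (R.arc 2) < s := fun z w hw hd =>
      (infDist_le_dist_of_mem (by rw [← h2]; exact mem_image_of_mem Ψ hw)).trans_lt
        (key z w (hsq (Or.inr hw)) hd)
    refine ⟨fun z hz => ?_, fun z hz => ?_, fun z hz => ?_⟩
    · obtain ⟨w, hw | hw, hd⟩ := hR z hz
      · exact Or.inl (harc0 z w hw hd)
      · exact Or.inr (harc2 z w hw hd)
    · obtain ⟨w, hw, hd⟩ := hA0 z hz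
      exact harc0 z w hw hd
    · obtain ⟨w, hw, hd⟩ := hA2 z hz
      exact harc2 z w hw hd
  -- assembling at a large index
  obtain ⟨m, hm1, hm2, hm3⟩ := (hidxQ.and (hU1.and hU6)).exists
  exact ⟨Q m, l m, hl m, ρ m, hrect m, hρc m, hρm m, hρs m, hρ1 m, hbd m, hcarQ m, hm1, hm2,
    (hreadQ m).1, (hreadQ m).2.1, s, hs, hm3.1, hm3.2.1, hm3.2.2, hsep⟩

end Summit.CriticalPhenomena.CardyFormulaZ2.Theorems.CardyQContinuation
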